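import Summits.ValiantsHypothesis.ValiantsHypothesis.Theorems.BarrierLeverAnchoredDoorHitsLowerPairsStarFacePivot
import Summits.ValiantsHypothesis.ValiantsHypothesis.Theorems.BarrierLeverAnchoredDoorHitsLowerPairsStarArrow

/-!
# Route BarrierLever — support item `AnchoredDoorHitsLowerPairs` (stmt-ValiantsHypothesis-22510), line `anchored_peeling`:
# THE FACE PIVOT AT THE DOOR LEVEL (val-np-p1 g32)

The item's residual nodes are phrased in `symbolicDet 2 h r u w ≠ 0` / `AnchoredHit 2 h r u w`. This file composes the FACE PIVOT of the
star-forest matrix (…StarFacePivot, p742818 / p742891: a row vertex `b₀` against a column face `T`, or a column vertex `e₀` against a row face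
`A₀`, with BALANCED star counts and NO lower-set hypothesis) with the landed bridge `StarDoor.symbolicDet_two_ne_zero_of_starDet` (…StarArrow,
p727740): for an injective LOWER pair, nonsingular star blocks for the link pair and the deletion pair of a balanced vertex–face pivot give
`symbolicDet 2 h r u w ≠ 0` and `AnchoredHit 2 h r u w`. (The vertex–vertex case is `symbolicDet_two_ne_zero_of_starPivot` of …StarCertificates.)
CENSUS of record (HOME/val-np-p1/g32, lab/rigid2.py): no balanced vertex–face pivot on either side for 80 of the 1 798 ordered lower pairs
on `5+5` vertices (vertex–vertex: 164). This file does NOT prove `Stmt.conjStarLower`; nothing here bears on crux 14610 or on `VP ≠ VNP`.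
-/

set_option linter.dupNamespace false

namespace Summit.ValiantsHypothesis.ValiantsHypothesis.Theorems.BarrierLever.AnchoredPeeling

open Finset

noncomputable section

namespace StarDoor

variable {h r : ℕ}

/-- **The face pivot at the door level:** for an injective lower pair `(u, w)`, a row vertex `b₀`, a set `T` of column vertices and a
permutation `σ` matching the columns containing `T` with the rows containing `b₀`, nonsingular star blocks for the link pair
`((u i) − b₀, (w (σ j)) ∖ T)_{b₀ ∈ u i}` and the deletion pair `(u i, w (σ j))_{b₀ ∉ u i}` give `symbolicDet 2 h r u w ≠ 0`. -/
theorem symbolicDet_two_ne_zero_of_facePivot (u w : Fin r → Finset (Fin h)) (hu : Function.Injective u) (hw : Function.Injective w)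
    (hlu : IsLowerSet (Set.range u)) (hlw : IsLowerSet (Set.range w)) (b₀ : Fin h) (T : Finset (Fin h)) (σ : Equiv.Perm (Fin r))
    (hσ : ∀ j, T ⊆ w (σ j) ↔ b₀ ∈ u j)
    (Hlk : ∃ g d : Fin h → Fin h → ℂ,
      (Matrix.of fun i j : {i : Fin r // b₀ ∈ u i} => starEntry g d ((u i).erase b₀) ((w (σ j)) \ T)).det ≠ 0)
    (Hdl : ∃ g d : Fin h → Fin h → ℂ,
      (Matrix.of fun i j : {i : Fin r // b₀ ∉ u i} => starEntry g d (u i) (w (σ j))).det ≠ 0) :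
    symbolicDet 2 h r u w ≠ 0 := by
  obtain ⟨g, d, hdet⟩ := starDet_ne_zero_of_facePivot u w b₀ T σ hσ Hlk Hdl
  exact symbolicDet_two_ne_zero_of_starDet g d u w hu hw hlu hlw hdet

/-- **The face pivot at the door level, swapped orientation:** a column vertex `e₀` against a set `A₀` of row vertices. -/
theorem symbolicDet_two_ne_zero_of_facePivot_swap (u w : Fin r → Finset (Fin h)) (hu : Function.Injective u) (hw : Function.Injective w)
    (hlu : IsLowerSet (Set.range u)) (hlw : IsLowerSet (Set.range w)) (e₀ : Fin h) (A₀ : Finset (Fin h)) (σ : Equiv.Perm (Fin r))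
    (hσ : ∀ i, A₀ ⊆ u (σ i) ↔ e₀ ∈ w i)
    (Hlk : ∃ g d : Fin h → Fin h → ℂ,
      (Matrix.of fun i j : {j : Fin r // e₀ ∈ w j} => starEntry g d ((u (σ i)) \ A₀) ((w j).erase e₀)).det ≠ 0)
    (Hdl : ∃ g d : Fin h → Fin h → ℂ,
      (Matrix.of fun i j : {j : Fin r // e₀ ∉ w j} => starEntry g d (u (σ i)) (w j)).det ≠ 0) :
    symbolicDet 2 h r u w ≠ 0 := by
  obtain ⟨g, d, hdet⟩ := starDet_ne_zero_of_facePivot_swap u w e₀ A₀ σ hσ Hlk Hdl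
  exact symbolicDet_two_ne_zero_of_starDet g d u w hu hw hlu hlw hdet

/-- **… as an anchored hit at profile 2.** -/
theorem anchoredHit_two_of_facePivot (u w : Fin r → Finset (Fin h)) (hu : Function.Injective u) (hw : Function.Injective w)
    (hlu : IsLowerSet (Set.range u)) (hlw : IsLowerSet (Set.range w)) (b₀ : Fin h) (T : Finset (Fin h)) (σ : Equiv.Perm (Fin r))
    (hσ : ∀ j, T ⊆ w (σ j) ↔ b₀ ∈ u j)
    (Hlk : ∃ g d : Fin h → Fin h → ℂ,
      (Matrix.of fun i j : {i : Fin r // b₀ ∈ u i} => starEntry g d ((u i).erase b₀) ((w (σ j)) \ T)).det ≠ 0)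
    (Hdl : ∃ g d : Fin h → Fin h → ℂ,
      (Matrix.of fun i j : {i : Fin r // b₀ ∉ u i} => starEntry g d (u i) (w (σ j))).det ≠ 0) :
    AnchoredHit 2 h r u w :=
  stub_genericPoint 2 h r u w (symbolicDet_two_ne_zero_of_facePivot u w hu hw hlu hlw b₀ T σ hσ Hlk Hdl)

/-- **… swapped orientation, as an anchored hit at profile 2.** -/
theorem anchoredHit_two_of_facePivot_swap (u w : Fin r → Finset (Fin h)) (hu : Function.Injective u) (hw : Function.Injective w)
    (hlu : IsLowerSet (Set.range u)) (hlw : IsLowerSet (Set.range w)) (e₀ : Fin h) (A₀ : Finset (Fin h)) (σ : Equiv.Perm (Fin r))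
    (hσ : ∀ i, A₀ ⊆ u (σ i) ↔ e₀ ∈ w i)
    (Hlk : ∃ g d : Fin h → Fin h → ℂ,
      (Matrix.of fun i j : {j : Fin r // e₀ ∈ w j} => starEntry g d ((u (σ i)) \ A₀) ((w j).erase e₀)).det ≠ 0)
    (Hdl : ∃ g d : Fin h → Fin h → ℂ,
      (Matrix.of fun i j : {j : Fin r // e₀ ∉ w j} => starEntry g d (u (σ i)) (w j)).det ≠ 0) :
    AnchoredHit 2 h r u w :=
  stub_genericPoint 2 h r u w (symbolicDet_two_ne_zero_of_facePivot_swap u w hu hw hlu hlw e₀ A₀ σ hσ Hlk Hdl)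

end StarDoor

end

end Summit.ValiantsHypothesis.ValiantsHypothesis.Theorems.BarrierLever.AnchoredPeeling
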